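import Literature.NumberTheory.Automorphic.ResGLnCoeffIntegralForm
import Literature.NumberTheory.Automorphic.CompletedCohomologyHeckeAlgebraGLn
import HarnessLib

/-!
# The lattice `M_λ ⊆ E_λ(ℚ̄_p)` is stable under `GL_n(𝒪̂_K)`, and the level `U_r` of the `p`-power
# tower acts trivially on `M_λ / p^s` for `r ≫ 0`

Topic `NumberTheory/Automorphic`; namespace `Literature.NumberTheory.Automorphic.ResGLnCohomology`.
Definitions with bodies and theorems; no named fact, no instance, no `sorry`.

Let `𝒪 ⊆ ℚ̄_p` be a subring receiving the integers of every completion `K_{v(τ)}` under the chosen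
continuous extensions `φ_τ : K_{v(τ)} → ℚ̄_p` of the embeddings `τ : K → ℚ̄_p`
(`ParallelWeight.padicPlace`, `padicPlaceHom`; hypothesis `h𝒪 : |y| ≤ 1 → φ_τ y ∈ 𝒪`, satisfied
e.g. by `𝒪 = ℤ̄_p` and by the integers of any finite `E/ℚ_p` containing all `φ_τ(K_{v(τ)})`).  For the
lattice `M_λ = coeffIntForm ℚ̄_p 𝒪 n K λ ⊆ E_λ(ℚ̄_p) = ⨂_τ V_{λ_τ}(ℚ̄_p)` (`ResGLnCoeffIntegralForm`)
and the action `padicCoeffRep n K p λ` of `GL_n(𝔸_K^∞)` through the `p`-adic places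
(`ResGLnAdelicCoefficients`):

* `padicCoeffRep_mem_coeffIntForm` — **`M_λ` is stable under `GL_n(𝒪̂_K)`** (`glFiniteIntegralLevel`),
  in particular under every `S`-good level `U` and its tower `U_r` (`…_of_mem_tower`): the
  `v(τ)`-component of an integral `u` is an invertible matrix over `𝒪_{v(τ)}` (`glOfMemSubring`), which
  acts through the `𝒪`-point `intPoint … τ u ∈ GL_n(𝒪)` (`ψ_τ = φ_τ|𝒪_{v(τ)} : 𝒪_{v(τ)} → 𝒪`,
  `padicPlaceIntHom`);
* `exists_forall_padicCoeffRep_sub_mem` — **for every `s` there is `r` with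
  `u x - x ∈ p^s M_λ` for all `u ∈ U_r`, `x ∈ M_λ`**: at a place `w ∋ p` an element of valuation
  `≤ |ϖ_w|^r`, `r ≫ 0`, is `p^s` times an integer (`exists_eq_pow_mul_of_valued_le`), so the
  `𝒪`-points of elements of `U_r = {u ∈ U | u_w ≡ 1 (mod ϖ_w^r), w ∣ p}` (`TameLevel.tower`) are
  `≡ 1 (mod p^s)`, and `ResGLnCohomology.adelicCoeffRep_sub_mem_smul_coeffIntForm` applies.

This is the sentence "we assume that `M_{ξ,K}` arises from a `K_p`-stable lattice `M_ξ` … Let `m` be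
any positive integer and `K_p` sufficiently small so that `M_ξ / p^m` is trivial as a
`K_p`-module" of [Scholze2015, §V.4, proof of Thm. V.4.1] (arXiv:1306.2070, p. 67), for the levels
`K_p K^p = U_r` of the tree's tower [CalegariEmerton2011, §1.1].

## References

* P. Scholze, *On torsion in the cohomology of locally symmetric varieties*, Ann. of Math. 182
  (2015), §V.4 (arXiv:1306.2070, pp. 66–67). [Scholze2015]
* F. Calegari, M. Emerton, *Completed cohomology — a survey* (2011), §1.1 (the tower). [CalegariEmerton2011]
-/

noncomputable section

open scoped NumberField TensorProduct
open IsDedekindDomain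

namespace Literature.NumberTheory.Automorphic.ResGLnCohomology

open BigHeckeGLn GLnCohomology

/-! ### Invertible matrices with entries in a subring -/

section Subring

variable {L : Type*} [CommRing L] {m : Type*} [Fintype m] [DecidableEq m]

/-- **An invertible matrix whose entries and whose inverse's entries lie in a subring `S` is an
invertible matrix over `S`.** [folklore] -/
def glOfMemSubring (S : Subring L) (g : GL m L) (h : ∀ i j, (g : Matrix m m L) i j ∈ S)
    (h' : ∀ i j, ((g⁻¹ : GL m L) : Matrix m m L) i j ∈ S) : GL m S where
  val := Matrix.of fun i j => ⟨(g : Matrix m m L) i j, h i j⟩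
  inv := Matrix.of fun i j => ⟨((g⁻¹ : GL m L) : Matrix m m L) i j, h' i j⟩
  val_inv := Matrix.map_injective S.subtype_injective (by
    change (_ * _ : Matrix m m S).map S.subtype = (1 : Matrix m m S).map S.subtype
    rw [Matrix.map_mul, Matrix.map_one _ (map_zero _) (map_one _)]
    change (g : Matrix m m L) * ((g⁻¹ : GL m L) : Matrix m m L) = 1
    rw [← Units.val_mul, mul_inv_cancel, Units.val_one])
  inv_val := Matrix.map_injective S.subtype_injective (by
    change (_ * _ : Matrix m m S).map S.subtype = (1 : Matrix m m S).map S.subtype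
    rw [Matrix.map_mul, Matrix.map_one _ (map_zero _) (map_one _)]
    change ((g⁻¹ : GL m L) : Matrix m m L) * (g : Matrix m m L) = 1
    rw [← Units.val_mul, inv_mul_cancel, Units.val_one])

/-- Entries of `glOfMemSubring`. [folklore] -/
@[simp]
theorem coe_glOfMemSubring_apply (S : Subring L) (g : GL m L) (h : ∀ i j, (g : Matrix m m L) i j ∈ S)
    (h' : ∀ i j, ((g⁻¹ : GL m L) : Matrix m m L) i j ∈ S) (i j : m) :
    (((glOfMemSubring S g h h' : GL m S) : Matrix m m S) i j : L) = (g : Matrix m m L) i j :=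
  rfl

/-- `glOfMemSubring` maps back to `g`. [folklore] -/
@[simp]
theorem map_subtype_glOfMemSubring (S : Subring L) (g : GL m L)
    (h : ∀ i j, (g : Matrix m m L) i j ∈ S) (h' : ∀ i j, ((g⁻¹ : GL m L) : Matrix m m L) i j ∈ S) :
    Matrix.GeneralLinearGroup.map S.subtype (glOfMemSubring S g h h') = g :=
  Matrix.GeneralLinearGroup.ext fun _ _ => rfl

end Subring

/-! ### At a place above `p`: small elements are `p^s` times integers -/

section Local

variable {K : Type} [Field K] [NumberField K] (p : ℕ) [Fact p.Prime]

/-- **At a finite place `w`, for every `s` there is `r` such that every `y ∈ K_w` with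
`|y|_w ≤ |ϖ_w|^r` is `p^s z` with `z ∈ 𝒪_w`** (take `|ϖ_w|^r = |p^s|_w`; `p^s ≠ 0`). [folklore] -/
theorem exists_eq_pow_mul_of_valued_le (w : HeightOneSpectrum (𝓞 K)) (s : ℕ) :
    ∃ r : ℕ, ∀ y : w.adicCompletion K,
      Valued.v y ≤ WithZero.exp (-(r : ℤ)) →
        ∃ z : w.adicCompletion K, Valued.v z ≤ 1 ∧ y = ((p : ℕ) : w.adicCompletion K) ^ s * z := by
  have hp : (p : ℕ).Prime := Fact.out
  -- `q = p^s`, as the image of `(p^s : K)`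
  set q : w.adicCompletion K := algebraMap K (w.adicCompletion K) (((p : ℕ) : K) ^ s) with hq
  have hqp : q = ((p : ℕ) : w.adicCompletion K) ^ s := by
    rw [hq, map_pow, map_natCast]
  have hq0 : q ≠ 0 :=
    (map_ne_zero (algebraMap K (w.adicCompletion K))).2 (pow_ne_zero s (Nat.cast_ne_zero.2 hp.ne_zero))
  have hq1 : Valued.v q ≤ 1 := by
    have h : q = ((((p : ℕ) : K) ^ s : K) : w.adicCompletion K) := rfl
    rw [h, HeightOneSpectrum.valuedAdicCompletion_eq_valuation',
      show ((p : ℕ) : K) ^ s = algebraMap (𝓞 K) K (((p : ℕ) : 𝓞 K) ^ s) by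
        rw [map_pow, map_natCast],
      HeightOneSpectrum.valuation_of_algebraMap]
    exact HeightOneSpectrum.intValuation_le_one w _
  have hv0 : Valued.v q ≠ 0 := (Valuation.ne_zero_iff _).2 hq0
  -- `|q| = exp m`, `m ≤ 0`; take `r = -m`
  set m : ℤ := WithZero.log (Valued.v q) with hm
  have hqm : Valued.v q = WithZero.exp m := (WithZero.exp_log hv0).symm
  have hm0 : m ≤ 0 := by
    rw [hqm, ← WithZero.exp_zero, WithZero.exp_le_exp] at hq1
    exact hq1
  refine ⟨(-m).toNat, fun y hy => ?_⟩
  have hr : ((-m).toNat : ℤ) = -m := Int.toNat_of_nonneg (neg_nonneg.2 hm0)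
  rw [hr, neg_neg, ← hqm] at hy
  refine ⟨y / q, ?_, ?_⟩
  · rw [map_div₀, div_le_one₀ (pos_iff_ne_zero.2 hv0)]
    exact hy
  · rw [← hqp, mul_div_assoc', mul_div_cancel_left₀ _ hq0]

/-- Entries of the identity matrix over a subring coerce to those over the ring. [folklore] -/
theorem coe_matrix_one_apply {R : Type*} [Ring R] {S : Type*} [SetLike S R] [SubringClass S R]
    (s : S) {m : Type*} [DecidableEq m] (i j : m) :
    (((1 : Matrix m m s) i j : s) : R) = (1 : Matrix m m R) i j := by
  rw [Matrix.one_apply, Matrix.one_apply]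
  split_ifs <;> rfl

/-- Ring homomorphisms preserve the entries of the identity matrix. [folklore] -/
theorem map_matrix_one_apply {A B : Type*} [NonAssocSemiring A] [NonAssocSemiring B] (f : A →+* B)
    {m : Type*} [DecidableEq m] (i j : m) :
    f ((1 : Matrix m m A) i j) = (1 : Matrix m m B) i j := by
  rw [Matrix.one_apply, Matrix.one_apply]
  split_ifs <;> simp

end Local

/-! ### `GL_n(𝒪̂_K)` acts on `E_λ(ℚ̄_p)` through `GL_n(𝒪)` -/

section Padic

variable (n : ℕ) (K : Type) [Field K] [NumberField K] (p : ℕ) [Fact p.Prime]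
  (lam : (K →+* PadicAlgCl p) → Fin n → ℤ) (𝒪 : Subring (PadicAlgCl p))
  (h𝒪 : ∀ (τ : K →+* PadicAlgCl p) (y : (ParallelWeight.padicPlace K p τ).adicCompletion K),
    Valued.v y ≤ 1 → ParallelWeight.padicPlaceHom K p τ y ∈ 𝒪)

/-- **`ψ_τ = φ_τ|𝒪_{v(τ)} : 𝒪_{v(τ)} → 𝒪`**, the chosen extension of `τ` on the integers of the
completion, with values in `𝒪`. [folklore] -/
def padicPlaceIntHom (τ : K →+* PadicAlgCl p) :
    ((ParallelWeight.padicPlace K p τ).adicCompletionIntegers K).toSubring →+* 𝒪 :=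
  ((ParallelWeight.padicPlaceHom K p τ).comp
      ((ParallelWeight.padicPlace K p τ).adicCompletionIntegers K).toSubring.subtype).codRestrict 𝒪
    fun y => h𝒪 τ y ((HeightOneSpectrum.mem_adicCompletionIntegers (𝓞 K) K _).1 y.2)

/-- `ψ_τ` is `φ_τ` on the underlying elements. [folklore] -/
@[simp]
theorem coe_padicPlaceIntHom_apply (τ : K →+* PadicAlgCl p)
    (y : ((ParallelWeight.padicPlace K p τ).adicCompletionIntegers K).toSubring) :
    ((padicPlaceIntHom K p 𝒪 h𝒪 τ y : 𝒪) : PadicAlgCl p) = ParallelWeight.padicPlaceHom K p τ y :=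
  rfl

variable {n K p} in
/-- The `v`-component of `u ∈ GL_n(𝒪̂_K)` has entries in `𝒪_v`. [folklore] -/
theorem localComponent_apply_mem {u : FiniteAdelicGL n K} (hu : u ∈ glFiniteIntegralLevel n K)
    (w : HeightOneSpectrum (𝓞 K)) (i j : Fin n) :
    ((localComponent n K w u : GL (Fin n) (w.adicCompletion K)) :
      Matrix (Fin n) (Fin n) (w.adicCompletion K)) i j ∈ (w.adicCompletionIntegers K).toSubring :=
  (mem_glFiniteIntegralLevel_iff.1 hu).1 i j w

variable {n K p} in
/-- The inverse of the `v`-component of `u ∈ GL_n(𝒪̂_K)` has entries in `𝒪_v`. [folklore] -/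
theorem localComponent_inv_apply_mem {u : FiniteAdelicGL n K} (hu : u ∈ glFiniteIntegralLevel n K)
    (w : HeightOneSpectrum (𝓞 K)) (i j : Fin n) :
    (((localComponent n K w u)⁻¹ : GL (Fin n) (w.adicCompletion K)) :
      Matrix (Fin n) (Fin n) (w.adicCompletion K)) i j ∈ (w.adicCompletionIntegers K).toSubring := by
  rw [← map_inv]
  exact (mem_glFiniteIntegralLevel_iff.1 hu).2 i j w

/-- **The `𝒪`-point through which an integral `u` acts at `τ`**: `ψ_τ(u_{v(τ)}) ∈ GL_n(𝒪)`.
[folklore] -/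
def intPoint (τ : K →+* PadicAlgCl p) (u : FiniteAdelicGL n K) (hu : u ∈ glFiniteIntegralLevel n K) :
    GL (Fin n) 𝒪 :=
  Matrix.GeneralLinearGroup.map (padicPlaceIntHom K p 𝒪 h𝒪 τ)
    (glOfMemSubring ((ParallelWeight.padicPlace K p τ).adicCompletionIntegers K).toSubring
      (localComponent n K (ParallelWeight.padicPlace K p τ) u)
      (localComponent_apply_mem hu _) (localComponent_inv_apply_mem hu _))

/-- Entries of `intPoint`: `ψ_τ` of the entries of `u_{v(τ)}`. [folklore] -/
theorem coe_intPoint_apply (τ : K →+* PadicAlgCl p) (u : FiniteAdelicGL n K)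
    (hu : u ∈ glFiniteIntegralLevel n K) (i j : Fin n) :
    (((intPoint n K p 𝒪 h𝒪 τ u hu : GL (Fin n) 𝒪) : Matrix (Fin n) (Fin n) 𝒪) i j : PadicAlgCl p) =
      ParallelWeight.padicPlaceHom K p τ
        (((localComponent n K (ParallelWeight.padicPlace K p τ) u :
          GL (Fin n) ((ParallelWeight.padicPlace K p τ).adicCompletion K)) :
            Matrix (Fin n) (Fin n) _) i j) :=
  rfl

/-- `u` acts at `τ` through its `𝒪`-point: `GL_n(φ_τ)(u_{v(τ)}) = intPoint τ u` in `GL_n(ℚ̄_p)`.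
[folklore] -/
theorem map_localComponent_eq_map_intPoint (τ : K →+* PadicAlgCl p) (u : FiniteAdelicGL n K)
    (hu : u ∈ glFiniteIntegralLevel n K) :
    Matrix.GeneralLinearGroup.map (ParallelWeight.padicPlaceHom K p τ)
        (localComponent n K (ParallelWeight.padicPlace K p τ) u) =
      Matrix.GeneralLinearGroup.map 𝒪.subtype (intPoint n K p 𝒪 h𝒪 τ u hu) :=
  Matrix.GeneralLinearGroup.ext fun _ _ => rfl

include h𝒪 in
/-- **`M_λ` is stable under `GL_n(𝒪̂_K)`.** [cite: Scholze2015, §V.4 (proof of Thm. V.4.1: "a K_p-stable lattice M_ξ")] -/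
theorem padicCoeffRep_mem_coeffIntForm {u : FiniteAdelicGL n K} (hu : u ∈ glFiniteIntegralLevel n K)
    {x : CoeffModule (PadicAlgCl p) n K lam} (hx : x ∈ coeffIntForm (PadicAlgCl p) 𝒪 n K lam) :
    padicCoeffRep n K p lam u x ∈ coeffIntForm (PadicAlgCl p) 𝒪 n K lam :=
  adelicCoeffRep_mem_coeffIntForm (PadicAlgCl p) 𝒪 n K lam _ _ (fun τ => intPoint n K p 𝒪 h𝒪 τ u hu)
    (fun τ => map_localComponent_eq_map_intPoint n K p 𝒪 h𝒪 τ u hu) hx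

include h𝒪 in
/-- `M_λ` is stable under every `S`-good level and its tower `U_r ⊆ U ⊆ GL_n(𝒪̂_K)`. [folklore] -/
theorem padicCoeffRep_mem_coeffIntForm_of_mem_tower (𝒰 : TameLevel n K p) (r : ℕ)
    {u : FiniteAdelicGL n K} (hu : u ∈ 𝒰.tower r)
    {x : CoeffModule (PadicAlgCl p) n K lam} (hx : x ∈ coeffIntForm (PadicAlgCl p) 𝒪 n K lam) :
    padicCoeffRep n K p lam u x ∈ coeffIntForm (PadicAlgCl p) 𝒪 n K lam :=
  padicCoeffRep_mem_coeffIntForm n K p lam 𝒪 h𝒪 (𝒰.le_glFiniteIntegralLevel (𝒰.tower_le r hu)) hx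

/-! ### `U_r` acts trivially on `M_λ / p^s` for `r ≫ 0` -/

/-- The congruence condition defining `U_r` at a place above `p`. [folklore] -/
theorem valued_sub_one_le_of_mem_tower (𝒰 : TameLevel n K p) (r : ℕ) {u : FiniteAdelicGL n K}
    (hu : u ∈ 𝒰.tower r) (w : HeightOneSpectrum (𝓞 K)) (hw : ((p : ℕ) : 𝓞 K) ∈ w.asIdeal)
    (i j : Fin n) :
    Valued.v ((((localComponent n K w u : GL (Fin n) (w.adicCompletion K)) :
        Matrix (Fin n) (Fin n) (w.adicCompletion K)) - 1) i j) ≤ WithZero.exp (-(r : ℤ)) := by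
  have h := (Subgroup.mem_iInf.1 (Subgroup.mem_inf.1 hu).2) ⟨w, hw⟩
  rw [Subgroup.mem_comap] at h
  exact (mem_valuedCongruenceSubgroup_iff.1 h).2.2 i j

include h𝒪 in
/-- **For every `s` there is `r` such that `U_r` acts trivially on `M_λ / p^s`**:
`u x - x ∈ p^s M_λ` for `u ∈ U_r`, `x ∈ M_λ`.
[cite: Scholze2015, §V.4 (proof of Thm. V.4.1: "K_p sufficiently small so that M_ξ/p^m is trivial as a K_p-module")] -/
theorem exists_forall_padicCoeffRep_sub_mem (𝒰 : TameLevel n K p) (s : ℕ) :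
    ∃ r : ℕ, ∀ u ∈ 𝒰.tower r, ∀ x ∈ coeffIntForm (PadicAlgCl p) 𝒪 n K lam,
      padicCoeffRep n K p lam u x - x ∈
        (Ideal.span {(((p : ℕ) : 𝒪) ^ s : 𝒪)}) • coeffIntForm (PadicAlgCl p) 𝒪 n K lam := by
  classical
  -- a radius good for every `τ`
  choose rτ hrτ using fun τ : K →+* PadicAlgCl p =>
    exists_eq_pow_mul_of_valued_le p (ParallelWeight.padicPlace K p τ) s
  refine ⟨Finset.univ.sup rτ, fun u hu x hx => ?_⟩
  have hu0 : u ∈ glFiniteIntegralLevel n K := 𝒰.le_glFiniteIntegralLevel (𝒰.tower_le _ hu)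
  refine adelicCoeffRep_sub_mem_smul_coeffIntForm (PadicAlgCl p) 𝒪 n K lam _ _ _
    (fun τ => intPoint n K p 𝒪 h𝒪 τ u hu0)
    (fun τ => map_localComponent_eq_map_intPoint n K p 𝒪 h𝒪 τ u hu0) (fun τ i j => ?_) hx
  -- the entry `(u_w - 1) i j` is `p^s z`, `z` integral
  set w := ParallelWeight.padicPlace K p τ with hw
  have hle : Valued.v ((((localComponent n K w u : GL (Fin n) (w.adicCompletion K)) :
      Matrix (Fin n) (Fin n) (w.adicCompletion K)) - 1) i j) ≤ WithZero.exp (-(rτ τ : ℤ)) := by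
    refine (valued_sub_one_le_of_mem_tower n K p 𝒰 _ hu w
      (ParallelWeight.natCast_mem_padicPlace K p τ) i j).trans ?_
    rw [WithZero.exp_le_exp, neg_le_neg_iff, Int.ofNat_le]
    exact Finset.le_sup (Finset.mem_univ τ)
  obtain ⟨z, hz, hyz⟩ := hrτ τ _ hle
  -- the same identity over `𝒪_w`, then push along `ψ_τ`
  set g₁ : GL (Fin n) (w.adicCompletionIntegers K).toSubring :=
    glOfMemSubring (w.adicCompletionIntegers K).toSubring (localComponent n K w u)
      (localComponent_apply_mem hu0 _) (localComponent_inv_apply_mem hu0 _) with hg₁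
  set A : Matrix (Fin n) (Fin n) (w.adicCompletionIntegers K).toSubring :=
    (g₁ : Matrix (Fin n) (Fin n) (w.adicCompletionIntegers K).toSubring) with hA
  set z' : (w.adicCompletionIntegers K).toSubring :=
    ⟨z, (HeightOneSpectrum.mem_adicCompletionIntegers (𝓞 K) K w).2 hz⟩ with hz'
  have hAz : (A - 1) i j = (((p : ℕ) : (w.adicCompletionIntegers K).toSubring) ^ s) * z' := by
    refine Subtype.ext ?_
    rw [Matrix.sub_apply, AddSubgroupClass.coe_sub, coe_matrix_one_apply, MulMemClass.coe_mul,
      SubmonoidClass.coe_pow]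
    exact (Matrix.sub_apply _ _ i j).symm.trans hyz
  have hentry : ((intPoint n K p 𝒪 h𝒪 τ u hu0 : GL (Fin n) 𝒪) : Matrix (Fin n) (Fin n) 𝒪) i j -
      (1 : Matrix (Fin n) (Fin n) 𝒪) i j = padicPlaceIntHom K p 𝒪 h𝒪 τ ((A - 1) i j) := by
    rw [Matrix.sub_apply, map_sub, map_matrix_one_apply]
    rfl
  rw [hentry, hAz, map_mul, map_pow, map_natCast]
  exact Ideal.mul_mem_right _ _ (Ideal.mem_span_singleton_self _)

end Padic

end Literature.NumberTheory.Automorphic.ResGLnCohomology
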